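import Summits.AnomalousDissipation.AnomalousDissipation.Theorems.WindLineWindyGalerkinSteadyZerothLawGenericLeafNondegeneracyToolsB
import Summits.AnomalousDissipation.AnomalousDissipation.Theorems.WindLineWindyGalerkinSteadyZerothLawGenericLeafNondegeneracyToolsD

/-!
# Generic leaf-nondegeneracy (stub B of crux `WindLine.WindyGalerkinSteadyZerothLaw`,
# stmt-AnomalousDissipation-11414), tools H: compactness and localisation of the steady solution sets

Helper layer (pure proof file, no definitions), in the lattice vocabulary of tools B–D (`W`, `B`, `D_M`,
force vectors `Y c`).  For `ν > 0`, `M = m` complexified and an admissible parameter `c₀`: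

* `tendsto_subseq_of_solutions` — solutions `xₙ` of `4π²ν xₙ + D xₙ + B(xₙ,xₙ) = Y cₙ` along a
  convergent sequence of parameters `cₙ → c₀` have a subsequence converging to a solution at `c₀`
  (a priori bound of tools D — every lattice solution is a classical steady state, tools C — and
  properness of tools B);
* `isCompact_solutionSet` — the solution set `Σ(c₀) = {x | 4π²ν x + D x + B(x,x) = Y c₀}` is compact;
* `exists_radius_solutions_subset` — **localisation**: every open `U ⊇ Σ(c₀)` contains all solutions
  for all parameters `c` with `‖c − c₀‖ < r`, for some `r > 0`.

References: Foias–Temam, CPAM 30 (1977) §1 (properness of the steady map); Saut–Temam 1980 §2.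
-/

noncomputable section

-- D-0017: single-problem summit ⇒ the duplicated namespace segment is by design.
set_option linter.dupNamespace false

open scoped BigOperators Topology ENNReal NNReal InnerProductSpace ComplexConjugate
open Filter Set Function TopologicalSpace MeasureTheory UnitAddTorus
open Literature.Analysis.FunctionSpaces Literature.Analysis.FunctionSpaces.Torus
open Literature.Analysis.FunctionSpaces.EuclideanSpace
open Literature.Analysis.FluidPDE Literature.Analysis.FluidPDE.Torus
open Literature.Analysis.FluidPDE.ScalarFourier
open Literature.Analysis.FluidPDE.SteadyLattice Literature.Analysis.FluidPDE.SteadyLatticeDrift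

namespace Summit.AnomalousDissipation.AnomalousDissipation.Theorems.WindLineWindyGalerkinSteadyZerothLaw.GenericLeaf

/-- The flat three-torus (local notation). -/
local notation "𝕋³" => UnitAddTorus (Fin 3)
/-- Velocity values (local notation). -/
local notation "E³" => EuclideanSpace ℝ (Fin 3)
/-- Complex coefficient vectors (local notation). -/
local notation "ℂ³" => EuclideanSpace ℂ (Fin 3)
/-- Square-summable coefficient families `ℤ³ → ℂ³` (local notation). -/
local notation "ℓ2" => lp (fun _ : Fin 3 → ℤ => EuclideanSpace ℂ (Fin 3)) 2
/-- Physical coefficients `x̌(k) = x(k)/|k|²` of a family (local notation, the tree's `cf`). -/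
local notation "cf[" X "]" =>
  ((fun mm : Fin 3 → ℤ => (((freqNormSq mm)⁻¹ : ℝ) : ℂ)) • (X : (Fin 3 → ℤ) → EuclideanSpace ℂ (Fin 3)))
/-- `k · v = ∑ⱼ kⱼ vⱼ` (local notation, the tree's `kdot`). -/
local notation "kdot[" k "," v "]" =>
  (∑ jj : Fin 3, (((k : Fin 3 → ℤ) jj : ℤ) : ℂ) * (v : EuclideanSpace ℂ (Fin 3)) jj)
/-- The convective symbol `N(a, b)(k)` as a vector of `ℂ³` (local notation, the tree's `nl`). -/
local notation "nl[" a "," b "," k "]" =>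
  ((WithLp.toLp 2 (fun pp : Fin 3 => transportSym (fun jj mm => (a : (Fin 3 → ℤ) → EuclideanSpace ℂ (Fin 3)) mm jj)
    (fun mm => (b : (Fin 3 → ℤ) → EuclideanSpace ℂ (Fin 3)) mm pp) k)) : EuclideanSpace ℂ (Fin 3))
set_option quotPrecheck false in
/-- admissible parameters -/
local notation "𝒜" => ({c : SymL2 (Fin 3) | c 0 = 0 ∧
  ∀ k : Fin 3 → ℤ, ∑ j : Fin 3, ((k j : ℤ) : ℂ) * c k j = 0} : Set (SymL2 (Fin 3)))
/-- the force of a parameter -/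
local notation "F⟦" c "⟧" => SymL2.field (fun k : Fin 3 → ℤ => Real.exp (freqNormSq k)) (c : SymL2 (Fin 3))

section Solutions

variable {W : Submodule ℝ ℓ2}
variable (hW : ∀ x : ℓ2, x ∈ W ↔ (((x : ℓ2) : (Fin 3 → ℤ) → ℂ³) 0 = 0 ∧
  (∀ kk : Fin 3 → ℤ, kdot[kk, ((x : ℓ2) : (Fin 3 → ℤ) → ℂ³) kk] = 0) ∧ IsConjSymm ((x : ℓ2) : (Fin 3 → ℤ) → ℂ³)))
variable (hWc : IsClosed (W : Set ℓ2))
variable (B : W → W → W)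
variable (hB : ∀ x y : W, (((B x y : W) : ℓ2) : (Fin 3 → ℤ) → ℂ³) = fun k =>
  lerayCoeff k nl[cf[((x : ℓ2) : (Fin 3 → ℤ) → ℂ³)], cf[((y : ℓ2) : (Fin 3 → ℤ) → ℂ³)], k])
variable (hBb : IsBoundedBilinearMap ℝ (fun p : W × W => B p.1 p.2))
variable {m : E³} (D : W →L[ℝ] W)
variable (hD : ∀ x : W, (((D x : W) : ℓ2) : (Fin 3 → ℤ) → ℂ³) = fun k =>
  (2 * Real.pi * Complex.I * kdot[k, complexify m]) • cf[((x : ℓ2) : (Fin 3 → ℤ) → ℂ³)] k)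
variable (Y : 𝒜 → W)
variable (hY : ∀ (c : 𝒜) (k : Fin 3 → ℤ), (((Y c : W) : ℓ2) : (Fin 3 → ℤ) → ℂ³) k = mFourierCoeff (complexify ∘ F⟦c⟧) k)
variable (hYlip : ∀ c c' : 𝒜, ‖Y c - Y c'‖ ≤ ‖(c : SymL2 (Fin 3)) - c'‖)

/-! ## §1 Every lattice solution is a state vector of a steady state, hence bounded -/

include hW hB hD hY in
/-- **Lattice solutions are state vectors of classical steady states with mean `m`.** [folklore] -/
theorem exists_steady_of_solution {ν : ℝ} (hν : 0 < ν) (c : 𝒜) (x : W)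
    (heq : (4 * Real.pi ^ 2 * ν) • x + D x + B x x = Y c) :
    ∃ (u : 𝕋³ → E³) (p : 𝕋³ → ℝ), IsSteadyNSState ν F⟦c⟧ u p ∧ IsSmooth u ∧
      mFourierCoeff (complexify ∘ u) 0 = complexify m ∧
      (((x : ℓ2) : (Fin 3 → ℤ) → ℂ³) = fun k => ((freqNormSq k : ℝ) : ℂ) • mFourierCoeff (complexify ∘ u) k) ∧
      cf[((x : ℓ2) : (Fin 3 → ℤ) → ℂ³)] = Function.update (mFourierCoeff (complexify ∘ u)) 0 0 := by
  obtain ⟨u, p, hst, hu, hû⟩ := exists_steadyState_of_latticeEq hW B hB D hD (conjVec_complexify m) hν c x (Y c) (hY c) heq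
  have hu0 : mFourierCoeff (complexify ∘ u) 0 = complexify m := by
    rw [hû, Pi.add_apply, cf_zero, zero_add, Pi.single_eq_same]
  refine ⟨u, p, hst, hu, hu0, funext fun k => ?_, by rw [hû, update_add_single_of_zero (cf_zero _) _]⟩
  by_cases hk : k = 0
  · subst hk
    rw [W_zero hW x, freqNormSq_zero, Complex.ofReal_zero, zero_smul]
  · rw [hû, Pi.add_apply, Pi.single_eq_of_ne hk, add_zero, cf_apply, smul_smul, ← Complex.ofReal_mul,
      mul_inv_cancel₀ (ne_of_gt (lt_of_lt_of_le one_pos (one_le_freqNormSq' hk))), Complex.ofReal_one, one_smul]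

include hW hB hD hY in
/-- **Uniform bound for lattice solutions over bounded parameters.** [folklore] -/
theorem exists_norm_solution_le {ν : ℝ} (hν : 0 < ν) (K : ℝ) :
    ∃ R : ℝ, ∀ (c : 𝒜), ‖(c : SymL2 (Fin 3))‖ ≤ K → ∀ x : W, (4 * Real.pi ^ 2 * ν) • x + D x + B x x = Y c → ‖x‖ ≤ R := by
  obtain ⟨R, hR⟩ := exists_norm_stateVec_le hW B hB D hD hν K (M := complexify m)
  refine ⟨R, fun c hc x heq => ?_⟩
  obtain ⟨u, p, hst, -, hu0, hx, -⟩ := exists_steady_of_solution hW B hB D hD Y hY hν c x heq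
  exact hR c hc u p hst hu0 x hx

/-! ## §2 Subsequences, compactness, localisation -/

include hW hWc hB hBb hD hY hYlip in
/-- **Solutions along a convergent sequence of parameters have a convergent subsequence**, whose limit
solves the limit equation. [folklore] -/
theorem tendsto_subseq_of_solutions {ν : ℝ} (hν : 0 < ν) (c : ℕ → 𝒜) (c₀ : 𝒜) (hc : Tendsto c atTop (𝓝 c₀))
    (x : ℕ → W) (hx : ∀ n, (4 * Real.pi ^ 2 * ν) • x n + D (x n) + B (x n) (x n) = Y (c n)) :
    ∃ (φ : ℕ → ℕ) (z : W), StrictMono φ ∧ Tendsto (x ∘ φ) atTop (𝓝 z) ∧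
      (4 * Real.pi ^ 2 * ν) • z + D z + B z z = Y c₀ := by
  -- parameters are bounded
  have hcs : Tendsto (fun n => ((c n : 𝒜) : SymL2 (Fin 3))) atTop (𝓝 (c₀ : SymL2 (Fin 3))) :=
    (continuous_subtype_val.tendsto c₀).comp hc
  obtain ⟨K, hK⟩ := (hcs.norm).bddAbove_range
  have hKn : ∀ n, ‖((c n : 𝒜) : SymL2 (Fin 3))‖ ≤ K := fun n => hK ⟨n, rfl⟩
  obtain ⟨R, hR⟩ := exists_norm_solution_le hW B hB D hD Y hY hν K
  have hxR : ∀ n, ‖x n‖ ≤ R := fun n => hR (c n) (hKn n) (x n) (hx n)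
  -- `Y cₙ → Y c₀`
  have hYc : Continuous Y := by
    refine (LipschitzWith.of_dist_le_mul (K := 1) fun a b => ?_).continuous
    rw [NNReal.coe_one, one_mul, dist_eq_norm, Subtype.dist_eq, dist_eq_norm]
    exact hYlip a b
  have hy : Tendsto (fun n => (4 * Real.pi ^ 2 * ν) • x n + D (x n) + B (x n) (x n)) atTop (𝓝 (Y c₀)) := by
    simp_rw [hx]
    exact (hYc.tendsto c₀).comp hc
  exact exists_tendsto_subseq_of_bounded B hB hBb D hD hWc (by positivity) x hxR hy

include hW hWc hB hBb hD hY hYlip in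
/-- **The solution set at a fixed parameter is compact.** [folklore] -/
theorem isCompact_solutionSet {ν : ℝ} (hν : 0 < ν) (c₀ : 𝒜) :
    IsCompact {x : W | (4 * Real.pi ^ 2 * ν) • x + D x + B x x = Y c₀} := by
  refine isCompact_iff_isSeqCompact.2 fun x hx => ?_
  obtain ⟨φ, z, hφ, hz, hGz⟩ := tendsto_subseq_of_solutions hW hWc B hB hBb D hD Y hY hYlip hν (fun _ => c₀) c₀
    tendsto_const_nhds x hx
  exact ⟨z, hGz, φ, hφ, hz⟩

include hW hWc hB hBb hD hY hYlip in
/-- **Localisation of solutions near a parameter**: an open set containing all solutions at `c₀`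
contains all solutions at every parameter close to `c₀`. [folklore] -/
theorem exists_radius_solutions_subset {ν : ℝ} (hν : 0 < ν) (c₀ : 𝒜) {U : Set W} (hU : IsOpen U)
    (hSU : {x : W | (4 * Real.pi ^ 2 * ν) • x + D x + B x x = Y c₀} ⊆ U) :
    ∃ r : ℝ, 0 < r ∧ ∀ c : 𝒜, ‖(c : SymL2 (Fin 3)) - c₀‖ < r → ∀ x : W,
      (4 * Real.pi ^ 2 * ν) • x + D x + B x x = Y c → x ∈ U := by
  by_contra h
  simp only [not_exists, not_and, not_forall, exists_prop] at h
  -- bad parameters `cₙ` with `‖cₙ − c₀‖ < 1/(n+1)` and solutions `xₙ ∉ U`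
  have hbad : ∀ n : ℕ, ∃ (c : 𝒜) (x : W), ‖(c : SymL2 (Fin 3)) - c₀‖ < 1 / (n + 1) ∧
      (4 * Real.pi ^ 2 * ν) • x + D x + B x x = Y c ∧ x ∉ U := by
    intro n
    obtain ⟨c, hc, x, hx, hxU⟩ := h (1 / (n + 1)) (by positivity)
    exact ⟨c, x, hc, hx, hxU⟩
  choose c x hc hx hxU using hbad
  have hct : Tendsto c atTop (𝓝 c₀) := by
    rw [tendsto_iff_dist_tendsto_zero]
    refine squeeze_zero (fun n => dist_nonneg) (fun n => ?_) tendsto_one_div_add_atTop_nhds_zero_nat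
    rw [Subtype.dist_eq, dist_eq_norm]
    exact (hc n).le
  obtain ⟨φ, z, hφ, hz, hGz⟩ := tendsto_subseq_of_solutions hW hWc B hB hBb D hD Y hY hYlip hν c c₀ hct x hx
  have hzU : z ∈ U := hSU hGz
  obtain ⟨n, hn⟩ := (hz.eventually_mem (hU.mem_nhds hzU)).exists
  exact hxU (φ n) hn

end Solutions

/-! ## §3 Registered sub-goal -/

/-- **Registered sub-goal `genericLeaf_toolsH`** (worker B of stub `stub_genericLeafNondegeneracy`):
localisation of the steady lattice solutions near a parameter, `exists_radius_solutions_subset` in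
Pi-form. [folklore] -/
theorem genericLeaf_toolsH : ∀ (W : Submodule ℝ ℓ2), (∀ x : ℓ2, x ∈ W ↔ (((x : ℓ2) : (Fin 3 → ℤ) → ℂ³) 0 = 0 ∧ (∀ kk : Fin 3 → ℤ, kdot[kk, ((x : ℓ2) : (Fin 3 → ℤ) → ℂ³) kk] = 0) ∧ IsConjSymm ((x : ℓ2) : (Fin 3 → ℤ) → ℂ³))) → IsClosed (W : Set ℓ2) → ∀ (B : W → W → W), (∀ x y : W, (((B x y : W) : ℓ2) : (Fin 3 → ℤ) → ℂ³) = fun k => lerayCoeff k nl[cf[((x : ℓ2) : (Fin 3 → ℤ) → ℂ³)], cf[((y : ℓ2) : (Fin 3 → ℤ) → ℂ³)], k]) → IsBoundedBilinearMap ℝ (fun p : W × W => B p.1 p.2) → ∀ (m : E³) (D : W →L[ℝ] W), (∀ x : W, (((D x : W) : ℓ2) : (Fin 3 → ℤ) → ℂ³) = fun k => (2 * Real.pi * Complex.I * kdot[k, complexify m]) • cf[((x : ℓ2) : (Fin 3 → ℤ) → ℂ³)] k) → ∀ (Y : 𝒜 → W), (∀ (c : 𝒜) (k : Fin 3 → ℤ),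 (((Y c : W) : ℓ2) : (Fin 3 → ℤ) → ℂ³) k = mFourierCoeff (complexify ∘ F⟦c⟧) k) → (∀ c c' : 𝒜, ‖Y c - Y c'‖ ≤ ‖(c : SymL2 (Fin 3)) - c'‖) → ∀ (ν : ℝ), 0 < ν → ∀ (c₀ : 𝒜) (U : Set W), IsOpen U → {x : W | (4 * Real.pi ^ 2 * ν) • x + D x + B x x = Y c₀} ⊆ U → ∃ r : ℝ, 0 < r ∧ ∀ c : 𝒜, ‖(c : SymL2 (Fin 3)) - c₀‖ < r → ∀ x : W, (4 * Real.pi ^ 2 * ν) • x + D x + B x x = Y c → x ∈ U :=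
  fun _ hW hWc B hB hBb _ D hD Y hY hYlip _ hν c₀ _ hU hSU =>
    exists_radius_solutions_subset hW hWc B hB hBb D hD Y hY hYlip hν c₀ hU hSU

end Summit.AnomalousDissipation.AnomalousDissipation.Theorems.WindLineWindyGalerkinSteadyZerothLaw.GenericLeaf

end
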